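import Summits.CriticalPhenomena.PercolationContinuityZ3.Theorems.PercNearOneGluingNoHeavyPcintDefectWordDiagram
import Summits.CriticalPhenomena.PercolationContinuityZ3.Theorems.PercNearOneGluingNoHeavyPcintClosingWordStructure
import HarnessLib

/-!
# CriticalPhenomena/PercolationContinuityZ3 — Theorems/PercNearOneGluingNoHeavyPcintDefectWordCensus.lean: a return word of length `2j + 1` on `j` axes has ONE DEFECT; its partner map is a chord diagram (combinatorial core of STRUCTURE law C5-L4, part 3a)

Lane prim-pcint, STRUCTURE rule «numerics ⇒ structure ⇒ conjecture» (prim-pcint-2 GEN 21); sequel of …PcintDefectWordDiagram, the one-defect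
analogue of …PcintClosingWordStructure.  A word of length `n = 2j + 1` on `ℤ^j` using every axis and ending within `ℓ¹`-distance `1` of the
origin has the letter census of ONE DEFECT (`defect_structure`): one axis `c⋆` carries a letter `(c⋆, β)` twice, and either
(i) `(c⋆, ¬β)` once and every other axis once in each direction (the defect axis is the closing axis), or
(ii) `(c⋆, ¬β)` twice, one axis `c₀` a single letter, and every other axis once in each direction.
(Each axis contributes `uses + |coordinate| = 2·max(#+, #−) ≥ 2` to `n + ℓ¹ ≤ 2j + 2`, so exactly one axis has `max = 2`.)
The PARTNER MAP of such a word (`partner`: the other copy of the same letter if there is one, else the position of the reversed letter if that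
is unique, else the closing point; `dpi`: the closing point partnered with the lone letter) is a chord diagram (`Census.isDiag_dpi`).
The sequel …PcintDefectWordStructure marks the two same-letter chords of the axis `c⋆` and proves full compatibility (…PcintDefectWordDiagram)
of the word with the resulting one-defect structure.

HONEST FRAMING: elementary finite combinatorics written for the mechanism theorem of law C5-L4 (all `m`).  No `sorry`; standard axioms.
Written by prim-pcint-2 gen 21 (prover-prim-pcint-2-g21-0), 2026-08-27.
-/

noncomputable section

namespace Summit.CriticalPhenomena.PercolationContinuityZ3.Theorems.Pcint.ChordDiag

open Literature.Probability.LatticeModels Literature.Probability.Percolation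
open Summit.CriticalPhenomena.PercolationContinuityZ3.Theorems.Pcint
open Summit.CriticalPhenomena.PercolationContinuityZ3.Theorems.Pcint.MemoryTail

variable {n j : ℕ}

/-! ### The letter census of a one-defect word -/

/-- `p + q + |p − q| = 2·max(p, q)`. [folklore] -/
theorem add_add_natAbs_sub (p q : ℕ) : p + q + ((p : ℤ) - q).natAbs = 2 * max p q := by
  rcases le_total p q with h | h
  · rw [max_eq_right h, show ((p : ℤ) - q) = -((q - p : ℕ) : ℤ) by rw [Nat.cast_sub h]; ring, Int.natAbs_neg,
      Int.natAbs_natCast]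
    omega
  · rw [max_eq_left h, show ((p : ℤ) - q) = ((p - q : ℕ) : ℤ) by rw [Nat.cast_sub h], Int.natAbs_natCast]
    omega

/-- `|p − q| = max − min`. [folklore] -/
theorem natAbs_sub_eq_max_sub_min (p q : ℕ) : ((p : ℤ) - q).natAbs = max p q - min p q := by
  have := add_add_natAbs_sub p q
  rcases le_total p q with h | h
  · rw [max_eq_right h, min_eq_left h] at *; omega
  · rw [max_eq_left h, min_eq_right h] at *; omega

/-- A sum of naturals equal to one has exactly one non-zero term, equal to one. [folklore] -/
theorem exists_unique_of_sum_eq_one {f : Fin j → ℕ} (h : ∑ c, f c = 1) :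
    ∃ c₀, f c₀ = 1 ∧ ∀ c, c ≠ c₀ → f c = 0 := by
  obtain ⟨c₀, -, hc₀⟩ := Finset.exists_ne_zero_of_sum_ne_zero (by rw [h]; exact one_ne_zero : ∑ c, f c ≠ 0)
  have h1 : f c₀ ≤ 1 := by rw [← h]; exact Finset.single_le_sum (fun _ _ => Nat.zero_le _) (Finset.mem_univ c₀)
  refine ⟨c₀, by omega, fun c hc => ?_⟩
  have := Finset.sum_le_sum_of_subset_of_nonneg (f := f) (Finset.subset_univ {c, c₀}) (fun _ _ _ => Nat.zero_le _)
  rw [Finset.sum_pair hc, h] at this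
  omega

/-- **The letter census of a one-defect word**: a word of length `2j + 1` on `ℤ^j` using all axes and ending next to the origin has one axis
`c⋆` with a letter `(c⋆, β)` twice and either (i) `(c⋆, ¬β)` once and all other axes once in each direction, or (ii) `(c⋆, ¬β)` twice, a single-letter
axis `c₀`, and all other axes once in each direction. [folklore] -/
theorem defect_structure {w : Fin n → Fin j × Bool} (hax : ∀ c, 1 ≤ uses w c) (hl1 : l1 (wordPos w n) ≤ 1) (hn : n + 1 = 2 * j + 2) :
    ∃ cs : Fin j, ∃ β : Bool, cnt w cs β = 2 ∧
      ((cnt w cs (!β) = 1 ∧ ∀ c, c ≠ cs → cnt w c true = 1 ∧ cnt w c false = 1) ∨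
       (cnt w cs (!β) = 2 ∧ ∃ c₀, c₀ ≠ cs ∧ uses w c₀ = 1 ∧ ∀ c, c ≠ cs → c ≠ c₀ → cnt w c true = 1 ∧ cnt w c false = 1)) := by
  set M : Fin j → ℕ := fun c => max (cnt w c true) (cnt w c false) with hM
  set D : Fin j → ℕ := fun c => ((cnt w c true : ℤ) - (cnt w c false : ℤ)).natAbs with hD
  have hT : ∀ c, uses w c + D c = 2 * M c := fun c => by rw [uses_eq]; exact add_add_natAbs_sub _ _
  have hM1 : ∀ c, 1 ≤ M c := fun c => by have := hax c; rw [uses_eq] at this; simp only [hM]; omega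
  have hsumD : ∑ c, D c = l1 (wordPos w n) := (l1_wordPos_eq w).symm
  have hsum : ∑ c, 2 * M c = n + l1 (wordPos w n) := by
    rw [← Finset.sum_congr rfl fun c _ => hT c, Finset.sum_add_distrib, sum_uses, hsumD]
  rw [← Finset.mul_sum] at hsum
  have hlow : ∑ c : Fin j, 1 ≤ ∑ c, M c := Finset.sum_le_sum fun c _ => hM1 c
  rw [Finset.sum_const, Finset.card_univ, Fintype.card_fin, smul_eq_mul, mul_one] at hlow
  -- parity: `n` is odd and `2·ΣM = n + ℓ¹` with `ℓ¹ ≤ 1`, so `ℓ¹ = 1` and `ΣM = j + 1`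
  have hl1eq : l1 (wordPos w n) = 1 := by omega
  have hSM : ∑ c, M c = j + 1 := by omega
  -- exactly one axis with `max = 2`
  have hS' : ∑ c, (M c - 1) = 1 := by
    have h2 : ∑ c, (M c - 1) + ∑ c : Fin j, 1 = ∑ c, M c := by
      rw [← Finset.sum_add_distrib]; exact Finset.sum_congr rfl fun c _ => by have := hM1 c; omega
    rw [Finset.sum_const, Finset.card_univ, Fintype.card_fin, smul_eq_mul, mul_one, hSM] at h2
    omega
  obtain ⟨cs, hcs, hcs'⟩ := exists_unique_of_sum_eq_one hS'
  have hMcs : M cs = 2 := by have := hM1 cs; omega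
  have hMc : ∀ c, c ≠ cs → M c = 1 := fun c hc => by have := hcs' c hc; have := hM1 c; omega
  -- exactly one axis with `|coordinate| = 1`
  rw [hl1eq] at hsumD
  obtain ⟨c₀, hc₀, hc₀'⟩ := exists_unique_of_sum_eq_one hsumD
  -- the doubled letter
  have hβ : ∃ β : Bool, cnt w cs β = 2 ∧ cnt w cs (!β) ≤ 2 := by
    simp only [hM] at hMcs
    rcases le_total (cnt w cs true) (cnt w cs false) with h | h
    · rw [max_eq_right h] at hMcs; exact ⟨false, hMcs, by simpa using h.trans hMcs.le⟩
    · rw [max_eq_left h] at hMcs; exact ⟨true, hMcs, by simpa using h.trans hMcs.le⟩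
  obtain ⟨β, hβ2, hβle⟩ := hβ
  refine ⟨cs, β, hβ2, ?_⟩
  have hDcs : D cs = max (cnt w cs true) (cnt w cs false) - min (cnt w cs true) (cnt w cs false) := natAbs_sub_eq_max_sub_min _ _
  -- the other axes
  have hother : ∀ c, c ≠ cs → c ≠ c₀ → cnt w c true = 1 ∧ cnt w c false = 1 := by
    intro c hc hc0
    have h1 := hMc c hc
    have h2 := hc₀' c hc0
    simp only [hM] at h1
    simp only [hD] at h2
    rw [natAbs_sub_eq_max_sub_min] at h2
    constructor <;> omega
  by_cases h0 : c₀ = cs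
  · -- case (i): the defect axis is the closing axis
    left
    subst h0
    simp only [hD] at hc₀
    rw [natAbs_sub_eq_max_sub_min] at hc₀
    simp only [hM] at hMcs
    refine ⟨?_, fun c hc => hother c hc hc⟩
    cases β <;> simp only [Bool.not_true, Bool.not_false] at hβ2 hβle ⊢ <;> omega
  · -- case (ii): a separate closing axis
    right
    have hD0 : D cs = 0 := hc₀' cs (Ne.symm h0)
    simp only [hD] at hD0
    rw [natAbs_sub_eq_max_sub_min] at hD0
    simp only [hM] at hMcs
    refine ⟨?_, c₀, h0, ?_, fun c hc hc0 => hother c hc hc0⟩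
    · cases β <;> simp only [Bool.not_true, Bool.not_false] at hβ2 ⊢ <;> omega
    · have h1 := hMc c₀ h0
      simp only [hM] at h1
      simp only [hD] at hc₀
      rw [natAbs_sub_eq_max_sub_min] at hc₀
      rw [uses_eq]; omega


/-! ### The census as a hypothesis; elementary consequences -/

/-- The ONE-DEFECT CENSUS of a word: axis `cs` carries `(cs, β)` twice and either `(cs, ¬β)` once with all other axes `(1,1)`, or `(cs, ¬β)`
twice, a single-letter axis, and all other axes `(1,1)`. [folklore] -/
def Census (w : Fin n → Fin j × Bool) (cs : Fin j) (β : Bool) : Prop :=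
  cnt w cs β = 2 ∧
    ((cnt w cs (!β) = 1 ∧ ∀ c, c ≠ cs → cnt w c true = 1 ∧ cnt w c false = 1) ∨
      (cnt w cs (!β) = 2 ∧ ∃ c₀, c₀ ≠ cs ∧ uses w c₀ = 1 ∧ ∀ c, c ≠ cs → c ≠ c₀ → cnt w c true = 1 ∧ cnt w c false = 1))

section Census

variable {w : Fin n → Fin j × Bool} {cs : Fin j} {β : Bool}

/-- A letter that occurs, occurs at least once. [folklore] -/
theorem one_le_cnt_self (w : Fin n → Fin j × Bool) (s : Fin n) : 1 ≤ cnt w (w s).1 (w s).2 :=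
  Finset.card_pos.2 ⟨s, Finset.mem_filter.2 ⟨Finset.mem_univ _, rfl⟩⟩

/-- Counts by axis bound counts by letter. [folklore] -/
theorem cnt_le_uses (w : Fin n → Fin j × Bool) (c : Fin j) (b : Bool) : cnt w c b ≤ uses w c := by
  rw [uses_eq]; cases b <;> omega

/-- Under the census every letter occurs at most twice. [folklore] -/
theorem Census.cnt_le_two (hC : Census w cs β) (c : Fin j) (b : Bool) : cnt w c b ≤ 2 := by
  obtain ⟨h2, hrest⟩ := hC
  by_cases hc : c = cs
  · subst hc
    rcases hrest with ⟨h1, -⟩ | ⟨h1, -⟩ <;>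
    · rcases Bool.eq_false_or_eq_true b with rfl | rfl <;> rcases Bool.eq_false_or_eq_true β with rfl | rfl <;>
        simp only [Bool.not_true, Bool.not_false] at h1 h2 ⊢ <;> omega
  · rcases hrest with ⟨-, hall⟩ | ⟨-, c₀, -, hu, hall⟩
    · have := hall c hc; cases b <;> omega
    · by_cases hc0 : c = c₀
      · subst hc0; have := cnt_le_uses w c b; omega
      · have := hall c hc hc0; cases b <;> omega

/-- Under the census, off the defect axis every letter occurs at most once. [folklore] -/
theorem Census.cnt_le_one (hC : Census w cs β) {c : Fin j} (hc : c ≠ cs) (b : Bool) : cnt w c b ≤ 1 := by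
  obtain ⟨-, hrest⟩ := hC
  rcases hrest with ⟨-, hall⟩ | ⟨-, c₀, -, hu, hall⟩
  · have := hall c hc; cases b <;> omega
  · by_cases hc0 : c = c₀
    · subst hc0; have := cnt_le_uses w c b; omega
    · have := hall c hc hc0; cases b <;> omega

/-- A letter occurring twice lies on the defect axis. [folklore] -/
theorem Census.eq_cs_of_cnt_two (hC : Census w cs β) {c : Fin j} {b : Bool} (h : cnt w c b = 2) : c = cs := by
  by_contra hc; have := hC.cnt_le_one hc b; omega

/-- The second letter of the defect axis occurs. [folklore] -/
theorem Census.one_le_cnt_odl (hC : Census w cs β) : 1 ≤ cnt w cs (!β) := by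
  rcases hC.2 with ⟨h1, -⟩ | ⟨h1, -⟩ <;> omega

/-- The positions of a letter occurring twice are two given distinct positions. [folklore] -/
theorem eq_or_eq_of_cnt_two {c : Fin j} {b : Bool} (h : cnt w c b = 2) {x y : Fin n} (hx : w x = (c, b)) (hy : w y = (c, b))
    (hxy : x ≠ y) {z : Fin n} (hz : w z = (c, b)) : z = x ∨ z = y := by
  unfold cnt at h
  have hsub : ({x, y} : Finset (Fin n)) ⊆ Finset.univ.filter fun t => w t = (c, b) := by
    intro t ht
    rw [Finset.mem_insert, Finset.mem_singleton] at ht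
    rcases ht with rfl | rfl <;> simp [hx, hy]
  have heq := Finset.eq_of_subset_of_card_le hsub (by rw [h, Finset.card_pair hxy])
  have hz' : z ∈ Finset.univ.filter fun t => w t = (c, b) := by simp [hz]
  rw [← heq, Finset.mem_insert, Finset.mem_singleton] at hz'
  exact hz'

/-- A letter occurring twice occurs at a position other than a given one. [folklore] -/
theorem exists_ne_of_cnt_two {c : Fin j} {b : Bool} (h : cnt w c b = 2) (s : Fin n) : ∃ t, t ≠ s ∧ w t = (c, b) := by
  unfold cnt at h
  obtain ⟨x, y, hxy, hS⟩ := Finset.card_eq_two.1 h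
  have hx : w x = (c, b) := by
    have : x ∈ Finset.univ.filter fun t => w t = (c, b) := by rw [hS]; simp
    exact (Finset.mem_filter.1 this).2
  have hy : w y = (c, b) := by
    have : y ∈ Finset.univ.filter fun t => w t = (c, b) := by rw [hS]; simp
    exact (Finset.mem_filter.1 this).2
  by_cases hxs : x = s
  · exact ⟨y, fun h => hxy (hxs.trans h.symm), hy⟩
  · exact ⟨x, hxs, hx⟩

/-! ### The partner map of a one-defect word -/

/-- The other position carrying the same letter (junk: `s`). [folklore] -/
def twin (w : Fin n → Fin j × Bool) (s : Fin n) : Fin n := if h : ∃ t, t ≠ s ∧ w t = w s then h.choose else s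

/-- The position carrying the reversed letter (junk: `s`). [folklore] -/
def opp (w : Fin n → Fin j × Bool) (s : Fin n) : Fin n := if h : ∃ t, w t = srev (w s) then h.choose else s

/-- **The partner of a letter**: its twin if the letter occurs twice, else the reversed letter if that occurs exactly once, else the closing
point. [folklore] -/
def partner (w : Fin n → Fin j × Bool) (s : Fin n) : Fin (n + 1) :=
  if cnt w (w s).1 (w s).2 = 2 then Fin.castSucc (twin w s)
  else if cnt w (w s).1 (!(w s).2) = 1 then Fin.castSucc (opp w s) else Fin.last n

/-- A LONE letter: one sent to the closing point (occurs once, its reverse not exactly once). [folklore] -/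
def IsLone (w : Fin n → Fin j × Bool) (ℓ : Fin n) : Prop := cnt w (w ℓ).1 (w ℓ).2 ≠ 2 ∧ cnt w (w ℓ).1 (!(w ℓ).2) ≠ 1

/-- **The diagram of a one-defect word** with lone letter `ℓ`: the partner map on the letters, the closing point partnered with `ℓ`. [folklore] -/
def dpi (w : Fin n → Fin j × Bool) (ℓ : Fin n) : Fin (n + 1) → Fin (n + 1) := fun x => Fin.lastCases (Fin.castSucc ℓ) (partner w) x

/-- `dpi` on a letter. [folklore] -/
@[simp] theorem dpi_castSucc (w : Fin n → Fin j × Bool) (ℓ s : Fin n) : dpi w ℓ (Fin.castSucc s) = partner w s := by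
  simp [dpi]

/-- `dpi` on the closing point. [folklore] -/
@[simp] theorem dpi_last (w : Fin n → Fin j × Bool) (ℓ : Fin n) : dpi w ℓ (Fin.last n) = Fin.castSucc ℓ := by
  simp [dpi]

/-- The twin of a doubled letter is another position with the same letter. [folklore] -/
theorem twin_spec {s : Fin n} (h2 : cnt w (w s).1 (w s).2 = 2) : twin w s ≠ s ∧ w (twin w s) = w s := by
  have hex : ∃ t, t ≠ s ∧ w t = w s := exists_ne_of_cnt_two h2 s
  unfold twin; rw [dif_pos hex]; exact hex.choose_spec

/-- The twin of the twin is the letter. [folklore] -/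
theorem twin_twin {s : Fin n} (h2 : cnt w (w s).1 (w s).2 = 2) : twin w (twin w s) = s := by
  obtain ⟨hts, hwt⟩ := twin_spec h2
  have h2' : cnt w (w (twin w s)).1 (w (twin w s)).2 = 2 := by rw [hwt]; exact h2
  obtain ⟨htt, hwtt⟩ := twin_spec h2'
  rw [hwt] at hwtt
  rcases eq_or_eq_of_cnt_two h2 rfl hwt hts.symm hwtt with h | h
  · exact h
  · exact absurd h htt

/-- The opposite of a letter whose reverse occurs once carries the reversed letter. [folklore] -/
theorem opp_spec {s : Fin n} (h1 : cnt w (w s).1 (!(w s).2) = 1) : w (opp w s) = srev (w s) := by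
  have hex : ∃ t, w t = srev (w s) := by
    obtain ⟨t, ht⟩ := exists_of_cnt_eq_one h1
    exact ⟨t, by rw [ht]; rfl⟩
  unfold opp; rw [dif_pos hex]; exact hex.choose_spec

/-- `partner` in the twin branch. [folklore] -/
theorem partner_of_two {s : Fin n} (h2 : cnt w (w s).1 (w s).2 = 2) : partner w s = Fin.castSucc (twin w s) := by
  unfold partner; rw [if_pos h2]

/-- `partner` in the reversed-letter branch. [folklore] -/
theorem partner_of_one {s : Fin n} (h2 : cnt w (w s).1 (w s).2 ≠ 2) (h1 : cnt w (w s).1 (!(w s).2) = 1) :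
    partner w s = Fin.castSucc (opp w s) := by
  unfold partner; rw [if_neg h2, if_pos h1]

/-- `partner` of a lone letter is the closing point. [folklore] -/
theorem partner_of_lone {s : Fin n} (h : IsLone w s) : partner w s = Fin.last n := by
  unfold partner; rw [if_neg h.1, if_neg h.2]

/-- Under the census a lone letter exists. [folklore] -/
theorem Census.exists_lone (hC : Census w cs β) : ∃ ℓ, IsLone w ℓ := by
  obtain ⟨h2, hrest⟩ := hC
  rcases hrest with ⟨h1, -⟩ | ⟨-, c₀, hc₀, hu, -⟩
  · obtain ⟨ℓ, hℓ⟩ := exists_of_cnt_eq_one h1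
    refine ⟨ℓ, ?_, ?_⟩ <;> rw [hℓ] <;> simp only [Bool.not_not] <;> omega
  · obtain ⟨ℓ, hℓ⟩ := exists_of_uses_eq_one hu
    have hb := cnt_le_uses w c₀ (w ℓ).2
    have hb' := cnt_le_uses w c₀ (!(w ℓ).2)
    have hs := one_le_cnt_self w ℓ
    rw [hℓ] at hs
    have hsum := uses_eq w c₀
    refine ⟨ℓ, ?_, ?_⟩ <;> rw [hℓ]
    · omega
    · cases hbb : (w ℓ).2 <;> rw [hbb] at hs <;> simp only [Bool.not_true, Bool.not_false] <;> omega

/-- Under the census the lone letter is unique. [folklore] -/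
theorem Census.lone_unique (hC : Census w cs β) {s t : Fin n} (hs : IsLone w s) (ht : IsLone w t) : s = t := by
  have h2 := hC.1
  rcases hC.2 with ⟨h1, hall⟩ | ⟨h1, c₀, hc₀, hu, hall⟩
  · -- case (i): a lone letter is the single letter `(cs, ¬β)`
    have key : ∀ u : Fin n, IsLone w u → w u = (cs, !β) := by
      intro u hu
      have hu1 := one_le_cnt_self w u
      by_cases hc : (w u).1 = cs
      · have hb : (w u).2 = !β := by
          by_contra hb
          have hb' : (w u).2 = β := by cases β <;> cases h' : (w u).2 <;> simp_all
          exact hu.1 (by rw [hc, hb']; exact h2)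
        exact Prod.ext hc hb
      · exfalso
        have := hall _ hc
        apply hu.2
        cases hb : (w u).2 <;> simp only [Bool.not_true, Bool.not_false] <;> omega
    exact eq_of_cnt_eq_one h1 (key s hs) (key t ht)
  · -- case (ii): a lone letter lies on the single-letter axis
    have key : ∀ u : Fin n, IsLone w u → (w u).1 = c₀ := by
      intro u hu
      have hu1 := one_le_cnt_self w u
      by_contra hc0
      by_cases hc : (w u).1 = cs
      · apply hu.1
        have := hC.cnt_le_two (w u).1 (w u).2
        rcases Bool.eq_false_or_eq_true ((w u).2) with hb | hb <;> rcases Bool.eq_false_or_eq_true β with hb' | hb' <;>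
          rw [hc, hb] at hu1 ⊢ <;> simp only [hb', Bool.not_true, Bool.not_false] at h1 h2 ⊢ <;> omega
      · have := hall _ hc hc0
        apply hu.2
        cases hb : (w u).2 <;> simp only [Bool.not_true, Bool.not_false] <;> omega
    exact eq_of_uses_eq_one hu (key s hs) (key t ht)

/-- **The diagram of a one-defect word is a chord diagram.** [folklore] -/
theorem Census.isDiag_dpi (hC : Census w cs β) {ℓ : Fin n} (hℓ : IsLone w ℓ) : IsDiag (dpi w ℓ) := by
  intro x
  induction x using Fin.lastCases with
  | last =>
    rw [dpi_last, dpi_castSucc, partner_of_lone hℓ]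
    exact ⟨rfl, (Fin.castSucc_lt_last ℓ).ne⟩
  | cast s =>
    rw [dpi_castSucc]
    by_cases h2 : cnt w (w s).1 (w s).2 = 2
    · obtain ⟨hts, hwt⟩ := twin_spec h2
      have h2' : cnt w (w (twin w s)).1 (w (twin w s)).2 = 2 := by rw [hwt]; exact h2
      rw [partner_of_two h2, dpi_castSucc, partner_of_two h2', twin_twin h2]
      exact ⟨rfl, fun h => hts (Fin.castSucc_injective _ h)⟩
    · by_cases h1 : cnt w (w s).1 (!(w s).2) = 1
      · have hwo := opp_spec h1
        have hos : opp w s ≠ s := fun h => srev_ne_self (w s) (by rw [← hwo, h])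
        -- the opposite letter is in the reversed-letter branch too, with opposite `s`
        have hcs : cnt w (w s).1 (w s).2 = 1 := by
          have := one_le_cnt_self w s; have := hC.cnt_le_two (w s).1 (w s).2; omega
        have h2o : cnt w (w (opp w s)).1 (w (opp w s)).2 ≠ 2 := by
          rw [hwo]; simp only [srev]; rw [h1]; decide
        have h1o : cnt w (w (opp w s)).1 (!(w (opp w s)).2) = 1 := by
          rw [hwo]; simp only [srev, Bool.not_not]; exact hcs
        rw [partner_of_one h2 h1, dpi_castSucc, partner_of_one h2o h1o]
        refine ⟨congrArg Fin.castSucc ?_, fun h => hos (Fin.castSucc_injective _ h)⟩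
        have hwoo := opp_spec h1o
        rw [hwo, srev_srev] at hwoo
        -- `w (opp (opp s)) = w s` and `w s` occurs once
        exact eq_of_cnt_eq_one (c := (w s).1) (b := (w s).2) hcs hwoo rfl
      · have hl : IsLone w s := ⟨h2, h1⟩
        rw [partner_of_lone hl, dpi_last, hC.lone_unique hℓ hl]
        exact ⟨rfl, (Fin.castSucc_lt_last s).ne'⟩

end Census

end Summit.CriticalPhenomena.PercolationContinuityZ3.Theorems.Pcint.ChordDiag
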